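import Literature.MathematicalPhysics.QuantumLattice.IsotropicMasterSmooth
import Literature.MathematicalPhysics.QuantumLattice.SectorSymbolMasterZero
import Mathlib.Analysis.SpecialFunctions.Complex.LogDeriv
import HarnessLib

/-!
# The isotropic master symbol at scale zero (Benfatto–Giuliani–Mastropietro 2006, Lemma 2.2b: preparation)

Topic `Literature/MathematicalPhysics/QuantumLattice`; the isotropic companion of
`SectorSymbolMasterBox` / `SectorSymbolMasterZero`, for `IsotropicMaster` / `IsotropicMasterSmooth`.
At `r = 0` the isotropic rescaled quantities are EXACTLY LINEAR in the chart variables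
`(t₁, t₂)` (first derivatives of smooth functions along the chart displacement
`v = t₁ n(θ₀) + t₂ τ(θ₀)`):

* `fderiv_arg_apply` — the real derivative of the argument, `D arg(x) w = Im(w/x)` on the slit plane;
* `isoRescaledDispersion_zero` — **`Ē(θ₀,t₁,t₂; 0) = normalGrad(θ₀) t₁`** (`∇ε(p_F) = a n`, `τ ⊥ ∇ε`);
* `isoRescaledAngle_zero` — **`Ā(θ₀,t₁,t₂; 0) = isoAngCoefN(θ₀) t₁ + t₂/s'(θ₀)`** (the derivative
  of the argument along `n` and `τ`; `isoAngCoefT = 1/s' > 0`);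
* the **uniform support box** `abs_le_of_isoMasterSymbol_ne_zero[_of_mem_Icc]` for `r ∈ [0, 1]`
  (`|t₀| ≤ e₀`, `|t₁| ≤ C̄₁`, `|t₂| ≤ C̄₂`, the constants of `IsotropicMasterSmooth`);
* **`isoMasterSymbol_zero_shear`** — with `c = 2 isoAngCoefN/isoAngCoefT`, the linear involution
  `(t₀, t₁, t₂) ↦ (-t₀, -t₁, t₂ + c t₁)` (a reflection along the ray: it flips `Ē₀`, fixes `Ā₀`)
  changes the sign of `Φ̄(·; 0)` — the "oddity" behind `|ḡ^{(h)}_ω̄(0)| ≤ Cγ^{3h}` (2.60a).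

Everything is PROVED; the definitions are the two angular coefficients and the shift.

## Sources

* G. Benfatto, A. Giuliani, V. Mastropietro, Ann. Henri Poincaré 7 (2006) 809–898, §2.5
  Lemma 2.2b (2.60a) (arXiv:cond-mat/0507686 p. 12). [BenfattoGiulianiMastropietro2006]
-/

noncomputable section

open Real Set Complex Function Metric Filter
open scoped Topology ComplexConjugate
open Literature.Analysis.Calculus Literature.Analysis.SpecialFunctions

namespace Literature.MathematicalPhysics.QuantumLattice

/-! ### The real derivative of the argument -/

/-- `arg` has real derivative `w ↦ Im(x⁻¹ w)` on the slit plane. [folklore] -/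
theorem hasStrictFDerivAt_arg {x : ℂ} (hx : x ∈ slitPlane) :
    HasStrictFDerivAt arg (Complex.imCLM.comp (x⁻¹ • (1 : ℂ →L[ℝ] ℂ))) x := by
  have h := (Complex.imCLM.hasStrictFDerivAt.comp x (hasStrictFDerivAt_log_real hx))
  refine h.congr_of_eventuallyEq ?_
  exact Eventually.of_forall fun w => by simp [Complex.log_im]

/-- `D arg(x) w = Im(x⁻¹ w)`. [folklore] -/
theorem fderiv_arg_apply {x : ℂ} (hx : x ∈ slitPlane) (w : ℂ) : fderiv ℝ arg x w = (x⁻¹ * w).im := by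
  rw [(hasStrictFDerivAt_arg hx).hasFDerivAt.fderiv]
  simp

/-! ### The rescaled quantities at `r = 0` -/

/-- The angular coefficient along the normal: `Im(e^{-iθ}(n₁ + i n₂))/u(θ)`. [folklore] -/
def isoAngCoefN (μ θ : ℝ) : ℝ := (fermiNormal μ θ 1 * Real.cos θ - fermiNormal μ θ 0 * Real.sin θ) / fermiRadius μ θ

/-- The angular coefficient along the tangent: `Im(e^{-iθ}(τ₁ + i τ₂))/u(θ)`. [folklore] -/
def isoAngCoefT (μ θ : ℝ) : ℝ := (fermiTangent μ θ 1 * Real.cos θ - fermiTangent μ θ 0 * Real.sin θ) / fermiRadius μ θ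

section Zero

variable {μ : ℝ} (hμ₁ : -4 < μ) (hμ₂ : μ < -2 - Real.sqrt 2)
include hμ₁ hμ₂

/-- **`isoAngCoefT = 1/s'(θ) > 0`** (`-τ₁ sin θ + τ₂ cos θ = u/s'`). [folklore] -/
theorem isoAngCoefT_eq (θ : ℝ) : isoAngCoefT μ θ = (fermiSpeed μ θ)⁻¹ := by
  have hu := fermiRadius_pos hμ₁ hμ₂ θ
  have hs := fermiSpeed_pos hμ₁ hμ₂ θ
  have hcs := Real.cos_sq_add_sin_sq θ
  rw [isoAngCoefT]
  simp only [fermiTangent, Pi.smul_apply, smul_eq_mul, Matrix.cons_val_zero, Matrix.cons_val_one, fermiVX, fermiVY]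
  field_simp
  linear_combination fermiRadius μ θ * hcs

/-- `isoAngCoefT > 0`. [folklore] -/
theorem isoAngCoefT_pos (θ : ℝ) : 0 < isoAngCoefT μ θ := by
  rw [isoAngCoefT_eq hμ₁ hμ₂]; exact inv_pos.2 (fermiSpeed_pos hμ₁ hμ₂ θ)

omit hμ₁ hμ₂ in
/-- `momToComplex` of the chart point: `u(θ₀)e^{iθ₀} + r (t₁ c_n + t₂ c_τ)`. [folklore] -/
theorem momToComplex_isoChartPoint (μ θ t₁ t₂ r : ℝ) :
    momToComplex (isoChartPoint μ (θ, t₁, t₂) r) =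
      momToComplex ![fermiX μ θ, fermiY μ θ] +
        (r : ℂ) * ((t₁ : ℂ) * momToComplex (fermiNormal μ θ) + (t₂ : ℂ) * momToComplex (fermiTangent μ θ)) := by
  apply Complex.ext
  · simp only [momToComplex_re, isoChartPoint_apply_zero, Complex.add_re, Complex.mul_re, Complex.ofReal_re,
      Complex.ofReal_im, Complex.add_im, Complex.mul_im, momToComplex_im, Matrix.cons_val_zero]
    ring
  · simp only [momToComplex_im, isoChartPoint_apply_one, Complex.add_im, Complex.mul_im, Complex.ofReal_re,
      Complex.ofReal_im, Complex.add_re, Complex.mul_re, momToComplex_re, Matrix.cons_val_one, Matrix.cons_val_fin_one]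
    ring

/-- The slice `r ↦ isoEpsFun (x, r)` has derivative `normalGrad(θ₀) t₁` at `r = 0`
(`Dε(p_F)(t₁n + t₂τ)`, `τ ⊥ ∇ε`). [cite: BenfattoGiulianiMastropietro2006, §2.5 (2.53)] -/
theorem hasDerivAt_isoEpsFun_slice_zero (θ t₁ t₂ : ℝ) :
    HasDerivAt (fun r : ℝ => isoEpsFun μ ((θ, t₁, t₂), r)) (normalGrad μ θ * t₁) 0 := by
  set v0 : ℝ := t₁ * fermiNormal μ θ 0 + t₂ * fermiTangent μ θ 0 with hv0
  set v1 : ℝ := t₁ * fermiNormal μ θ 1 + t₂ * fermiTangent μ θ 1 with hv1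
  have hc0 : HasDerivAt (fun r : ℝ => Real.cos (fermiX μ θ + r * v0)) (-Real.sin (fermiX μ θ) * v0) 0 := by
    have := (Real.hasDerivAt_cos (fermiX μ θ + 0 * v0)).comp (0 : ℝ) (((hasDerivAt_id (0 : ℝ)).mul_const v0).const_add _)
    simpa [Function.comp_def] using this
  have hc1 : HasDerivAt (fun r : ℝ => Real.cos (fermiY μ θ + r * v1)) (-Real.sin (fermiY μ θ) * v1) 0 := by
    have := (Real.hasDerivAt_cos (fermiY μ θ + 0 * v1)).comp (0 : ℝ) (((hasDerivAt_id (0 : ℝ)).mul_const v1).const_add _)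
    simpa [Function.comp_def] using this
  have h := ((hc0.add hc1).const_mul (-2 : ℝ)).sub_const μ
  have hval : -2 * (-Real.sin (fermiX μ θ) * v0 + -Real.sin (fermiY μ θ) * v1) = normalGrad μ θ * t₁ := by
    have hn := grad_fermi_dot_fermiNormal hμ₁ hμ₂ θ
    have hτ := grad_fermi_dot_fermiTangent hμ₁ hμ₂ θ θ
    rw [sub_self, Real.sin_zero, mul_zero, neg_zero] at hτ
    rw [hv0, hv1]
    linear_combination t₁ * hn + t₂ * hτ
  rw [hval] at h
  have key : (fun r : ℝ => isoEpsFun μ ((θ, t₁, t₂), r)) =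
      fun r => -2 * (Real.cos (fermiX μ θ + r * v0) + Real.cos (fermiY μ θ + r * v1)) - μ := by
    funext r
    simp only [isoEpsFun, sqDispersion, isoChartPoint_apply_zero, isoChartPoint_apply_one, hv0, hv1]
  rw [key]
  simpa only [Pi.add_apply] using h

/-- **`Ē(θ₀, t₁, t₂; 0) = normalGrad(θ₀) t₁`** — at `r = 0` the isotropic rescaled dispersion is exactly
linear in the normal variable. [cite: BenfattoGiulianiMastropietro2006, §2.5 Lemma 2.2b] -/
theorem isoRescaledDispersion_zero (θ t₁ t₂ : ℝ) :
    isoRescaledDispersion μ ((θ, t₁, t₂), 0) = normalGrad μ θ * t₁ := by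
  rw [isoRescaledDispersion, slopeQuot_zero]
  have hdiff : DifferentiableAt ℝ (isoEpsFun μ) ((θ, t₁, t₂), 0) :=
    ((contDiff_isoEpsFun hμ₁ hμ₂).differentiable (by simp)).differentiableAt
  have hline : HasDerivAt (fun r : ℝ => (((θ, t₁, t₂), r) : (ℝ × ℝ × ℝ) × ℝ)) ((0 : ℝ × ℝ × ℝ), (1 : ℝ)) 0 :=
    (hasDerivAt_const (0 : ℝ) (θ, t₁, t₂)).prodMk (hasDerivAt_id 0)
  have hcomp := hdiff.hasFDerivAt.comp_hasDerivAt (0 : ℝ) hline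
  exact hcomp.unique (hasDerivAt_isoEpsFun_slice_zero hμ₁ hμ₂ θ t₁ t₂)

/-- Near `u(θ₀) > 0` the truncated argument is the argument. [folklore] -/
theorem truncArg_eventuallyEq_arg (θ : ℝ) :
    truncArg (truncRadius μ) (Real.cos (7 * π / 8)) (Real.cos (15 * π / 16)) =ᶠ[𝓝 ((fermiRadius μ θ : ℝ) : ℂ)] arg := by
  have hu := fermiRadius_pos hμ₁ hμ₂ θ
  have hr : truncRadius μ < fermiRadius μ θ := by
    have h2 : 2 * truncRadius μ ≤ fermiRadius μ θ := by
      rw [two_mul_truncRadius]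
      exact le_trans (Real.sqrt_le_sqrt (by linarith)) (sqrt_le_fermiRadius hμ₁ hμ₂ θ)
    linarith [truncRadius_pos hμ₁ (μ := μ)]
  -- the open conditions `‖u‖ > r` and `Re u/‖u‖ > cos(7π/8)` hold at `u₀` (where the ratio is `1`)
  have hcont : ContinuousAt (fun u : ℂ => u.re / ‖u‖) (fermiRadius μ θ : ℂ) :=
    (contDiffAt_re_div_norm (by exact_mod_cast hu.ne') (n := 0)).continuousAt
  have hratio : Real.cos (7 * π / 8) < ((fermiRadius μ θ : ℂ)).re / ‖((fermiRadius μ θ : ℝ) : ℂ)‖ := by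
    rw [Complex.ofReal_re, Complex.norm_real, Real.norm_eq_abs, abs_of_pos hu, div_self hu.ne']
    have : Real.cos (7 * π / 8) < Real.cos 0 :=
      Real.cos_lt_cos_of_nonneg_of_le_pi le_rfl (by linarith [pi_pos]) (by positivity)
    rwa [Real.cos_zero] at this
  have hev1 : ∀ᶠ u in 𝓝 ((fermiRadius μ θ : ℝ) : ℂ), Real.cos (7 * π / 8) < u.re / ‖u‖ := hcont.eventually (lt_mem_nhds hratio)
  have hev2 : ∀ᶠ u in 𝓝 ((fermiRadius μ θ : ℝ) : ℂ), truncRadius μ < ‖u‖ := by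
    have : ContinuousAt (fun u : ℂ => ‖u‖) (fermiRadius μ θ : ℂ) := continuous_norm.continuousAt
    refine this.eventually (lt_mem_nhds ?_)
    show truncRadius μ < ‖((fermiRadius μ θ : ℝ) : ℂ)‖
    rwa [Complex.norm_real, Real.norm_eq_abs, abs_of_pos hu]
  filter_upwards [hev1, hev2] with u h1 h2
  exact truncArg_eq_arg (truncRadius_pos hμ₁) cos_fifteen_lt_cos_seven h2.le h1.le

/-- The slice `r ↦ isoAngFun (x, r)` has derivative `isoAngCoefN t₁ + isoAngCoefT t₂` at `r = 0`. [folklore] -/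
theorem hasDerivAt_isoAngFun_slice_zero (θ t₁ t₂ : ℝ) :
    HasDerivAt (fun r : ℝ => isoAngFun μ ((θ, t₁, t₂), r)) (isoAngCoefN μ θ * t₁ + isoAngCoefT μ θ * t₂) 0 := by
  have hu := fermiRadius_pos hμ₁ hμ₂ θ
  set u₀ : ℂ := ((fermiRadius μ θ : ℝ) : ℂ) with hu₀
  set W : ℂ := ((t₁ : ℂ) * momToComplex (fermiNormal μ θ) + (t₂ : ℂ) * momToComplex (fermiTangent μ θ)) *
    Complex.exp (-((θ : ℝ) * I)) with hW
  -- `u(x, r) = u₀ + r W`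
  have h00 : momToComplex ![fermiX μ θ, fermiY μ θ] * Complex.exp (-((θ : ℝ) * I)) = u₀ := by
    have := isoUFun_zero (μ := μ) (θ, t₁, t₂)
    rwa [isoUFun, isoChartPoint_zero] at this
  have huline : ∀ r : ℝ, isoUFun μ (θ, t₁, t₂) r = u₀ + (r : ℂ) * W := by
    intro r
    rw [isoUFun, momToComplex_isoChartPoint, add_mul, h00, hW]
    simp only
    ring
  have hslit : u₀ ∈ slitPlane := by rw [hu₀]; exact Complex.ofReal_mem_slitPlane.2 hu
  have hline : HasDerivAt (fun r : ℝ => u₀ + (r : ℂ) * W) W 0 := by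
    have h1 : HasDerivAt (fun r : ℝ => (r : ℂ) * W) W 0 := by
      simpa using (Complex.ofRealCLM.hasDerivAt (x := (0 : ℝ))).mul_const W
    exact h1.const_add u₀
  -- `truncArg = arg` near `u₀`, so the derivative is `Im(u₀⁻¹ W)`
  have hT : HasFDerivAt (truncArg (truncRadius μ) (Real.cos (7 * π / 8)) (Real.cos (15 * π / 16)))
      (Complex.imCLM.comp (u₀⁻¹ • (1 : ℂ →L[ℝ] ℂ))) u₀ :=
    (hasStrictFDerivAt_arg hslit).hasFDerivAt.congr_of_eventuallyEq (truncArg_eventuallyEq_arg hμ₁ hμ₂ θ)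
  have hT' : HasFDerivAt (truncArg (truncRadius μ) (Real.cos (7 * π / 8)) (Real.cos (15 * π / 16)))
      (Complex.imCLM.comp (u₀⁻¹ • (1 : ℂ →L[ℝ] ℂ))) ((fun r : ℝ => u₀ + (r : ℂ) * W) 0) := by
    simpa using hT
  have hcomp := hT'.comp_hasDerivAt (0 : ℝ) hline
  have hval : (Complex.imCLM.comp (u₀⁻¹ • (1 : ℂ →L[ℝ] ℂ))) W = isoAngCoefN μ θ * t₁ + isoAngCoefT μ θ * t₂ := by
    simp only [ContinuousLinearMap.coe_comp, Function.comp_apply, FunLike.coe_smul, Pi.smul_apply,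
      one_apply_eq_self, smul_eq_mul, Complex.imCLM_apply]
    rw [hu₀, hW, isoAngCoefN, isoAngCoefT]
    rw [← Complex.ofReal_inv]
    simp only [Complex.mul_im, Complex.ofReal_re, Complex.ofReal_im, Complex.add_re, Complex.add_im, Complex.mul_re,
      momToComplex_re, momToComplex_im, Complex.exp_re, Complex.exp_im, Complex.neg_re, Complex.neg_im,
      Complex.I_re, Complex.I_im]
    simp
    field_simp
    ring
  rw [hval] at hcomp
  refine hcomp.congr_of_eventuallyEq (Eventually.of_forall fun r => ?_)
  simp [isoAngFun, huline]

/-- **`Ā(θ₀, t₁, t₂; 0) = isoAngCoefN(θ₀) t₁ + isoAngCoefT(θ₀) t₂`** — exactly linear at `r = 0`. [cite: BenfattoGiulianiMastropietro2006, §2.5 Lemma 2.2b] -/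
theorem isoRescaledAngle_zero (θ t₁ t₂ : ℝ) :
    isoRescaledAngle μ ((θ, t₁, t₂), 0) = isoAngCoefN μ θ * t₁ + isoAngCoefT μ θ * t₂ := by
  rw [isoRescaledAngle, slopeQuot_zero]
  have hdiff : DifferentiableAt ℝ (isoAngFun μ) ((θ, t₁, t₂), 0) :=
    ((contDiff_isoAngFun hμ₁ hμ₂).differentiable (by simp)).differentiableAt
  have hline : HasDerivAt (fun r : ℝ => (((θ, t₁, t₂), r) : (ℝ × ℝ × ℝ) × ℝ)) ((0 : ℝ × ℝ × ℝ), (1 : ℝ)) 0 :=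
    (hasDerivAt_const (0 : ℝ) (θ, t₁, t₂)).prodMk (hasDerivAt_id 0)
  have hcomp := hdiff.hasFDerivAt.comp_hasDerivAt (0 : ℝ) hline
  exact hcomp.unique (hasDerivAt_isoAngFun_slice_zero hμ₁ hμ₂ θ t₁ t₂)


/-! ### The support box, uniformly in the scale parameter -/

/-- **The uniform support box** (BGM 2003 Lemma 7.3 with continuous width `w = πs`): for
`0 < e₀ ≤ (4+μ)/2`, `0 < s ≤ 1`, if `Φ̂(θ₀, t₁, t₂; t₀; s) ≠ 0` then `|t₀| ≤ e₀`, `|t₁| ≤ C₁`, `|t₂| ≤ C₂`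
with the constants of `SectorSymbolMasterSmooth`. [cite: BenfattoGiulianiMastropietro2003, §7.1 Lemma 7.3] -/
theorem abs_le_of_isoMasterSymbol_ne_zero {e₀ : ℝ} (he : 0 < e₀) (he' : e₀ ≤ (4 + μ) / 2) {θ₀ t₀ t₁ t₂ s : ℝ}
    (hs : 0 < s) (hs1 : s ≤ 1) (h : isoMasterSymbol μ e₀ (θ₀, t₁, t₂) t₀ s ≠ 0) :
    |t₀| ≤ e₀ ∧ |t₁| ≤ isoNormalConst μ e₀ ∧ |t₂| ≤ isoTangentConst μ e₀ := by
  set x : ℝ × ℝ × ℝ := (θ₀, t₁, t₂) with hx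
  set k : Fin 2 → ℝ := isoChartPoint μ x s with hk
  set E : ℝ := isoRescaledDispersion μ (x, s) with hE
  set u : ℂ := isoUFun μ x s with hu
  -- the nonvanishing factors
  rw [isoMasterSymbol] at h
  have hG : gnShell 4 e₀ 0 (Real.sqrt (t₀ ^ 2 + E ^ 2)) ≠ 0 := by
    intro h0; apply h; rw [← hE, h0]; simp
  have hψ : truncOne (2 * truncRadius μ) (Real.cos (3 * π / 4)) (Real.cos (7 * π / 8)) u ≠ 0 := by
    intro h0; apply h; rw [← hu, h0]; simp
  have hW : sectorUnitWeight (isoRescaledAngle μ (x, s) / π) ≠ 0 := by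
    intro h0; apply h; rw [h0]; simp
  have hχ : zoneBump k ≠ 0 := by
    intro h0; apply h; rw [← hk, h0]; simp
  clear h
  -- (a) the shell: `|t₀| < e₀`, `|E| < e₀`
  have hmem := mem_Ioo_of_gnShell_zero_ne_zero he hG
  have hsq : t₀ ^ 2 + E ^ 2 < e₀ ^ 2 := by
    have h1 := hmem.2
    have h2 : Real.sqrt (t₀ ^ 2 + E ^ 2) ^ 2 < e₀ ^ 2 := by
      exact pow_lt_pow_left₀ h1 (Real.sqrt_nonneg _) two_ne_zero
    rwa [Real.sq_sqrt (by positivity)] at h2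
  have ht₀ : |t₀| ≤ e₀ := abs_le_of_sq_le_sq' (by nlinarith [sq_nonneg E]) he.le |> fun h => abs_le.2 h
  have hEabs : |E| < e₀ := abs_lt_of_sq_lt_sq' (by nlinarith [sq_nonneg t₀]) he.le |> fun h => abs_lt.2 h
  -- (b) the dispersion: `|ε(k) - μ| < e₀ s`
  have hε : sqDispersion k - μ = s * E := isoEpsFun_eq_mul_isoRescaledDispersion hμ₁ hμ₂ x s
  have hεabs : |sqDispersion k - μ| < e₀ * s := by
    rw [hε, abs_mul, abs_of_pos hs, mul_comm]
    exact mul_lt_mul_of_pos_right hEabs hs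
  have hεabs1 : |sqDispersion k - μ| < e₀ := hεabs.trans_le (by nlinarith)
  -- (c) the zone and the lower bound on `|k|`
  have hkπ : ‖momToComplex k‖ ≤ π / 2 := norm_le_of_zoneBump_ne_zero hχ
  set m₀ := Real.sqrt ((4 + μ) / 2) with hm₀
  have hm₀pos : 0 < m₀ := Real.sqrt_pos.2 (by linarith)
  have hρgt : m₀ < ‖momToComplex k‖ := by
    have h1 : 4 + μ - e₀ < ‖momToComplex k‖ ^ 2 := by
      have := sqDispersion_le_norm_sq k
      have h2 := (abs_lt.1 hεabs1).1
      linarith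
    have h2 : (4 + μ) / 2 ≤ 4 + μ - e₀ := by linarith
    calc m₀ = Real.sqrt ((4 + μ) / 2) := hm₀
      _ < Real.sqrt (‖momToComplex k‖ ^ 2) := Real.sqrt_lt_sqrt (by linarith) (by linarith)
      _ = ‖momToComplex k‖ := Real.sqrt_sq (norm_nonneg _)
  have hρpos : 0 < ‖momToComplex k‖ := hm₀pos.trans hρgt
  have hk0 : k ≠ 0 := by
    intro h0; rw [h0, (momToComplex_eq_zero_iff 0).2 rfl, norm_zero] at hρpos; exact lt_irrefl _ hρpos
  -- (e) the relative angle: `|arg u| < ¾ π s`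
  have hu0 : u ≠ 0 := by rw [hu, ← norm_pos_iff, norm_isoUFun]; exact hρpos
  have hnu : 2 * truncRadius μ ≤ ‖u‖ := by rw [two_mul_truncRadius, hu, norm_isoUFun]; exact hρgt.le
  have hru : truncRadius μ ≤ ‖u‖ := by linarith [truncRadius_pos hμ₁ (μ := μ)]
  have harg7 : |arg u| < 7 * π / 8 := by
    by_contra hle
    push Not at hle
    exact hψ (truncOne_eq_zero_of_le_abs_arg cos_seven_lt_cos_three (by positivity) le_rfl hu0 hle)
  have htr : truncArg (truncRadius μ) (Real.cos (7 * π / 8)) (Real.cos (15 * π / 16)) u = arg u :=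
    truncArg_eq_arg_of_abs_arg_le (truncRadius_pos hμ₁) cos_fifteen_lt_cos_seven (by linarith [pi_pos]) le_rfl hru harg7.le
  have hÃ : arg u = s * isoRescaledAngle μ (x, s) := by
    have h1 := isoAngFun_eq_mul_isoRescaledAngle hμ₁ hμ₂ x s
    rw [isoAngFun] at h1
    simp only at h1
    rw [← hu, htr] at h1
    exact h1
  have hargs : |arg u| < 3 / 4 * π * s := by
    have h1 : |isoRescaledAngle μ (x, s) / π| < 3 / 4 := by
      by_contra hle; push Not at hle; exact hW (sectorUnitWeight_eq_zero hle)
    rw [abs_div, abs_of_pos pi_pos, div_lt_iff₀ pi_pos] at h1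
    rw [hÃ, abs_mul, abs_of_pos hs]
    nlinarith
  -- (f) polar representation through `θ' = θ₀ + arg u`
  obtain ⟨j, hj⟩ := polarAngle_eq_add_sectorRelAngle θ₀ hk0
  have hrel : sectorRelAngle θ₀ k = arg u := by rw [hu, arg_isoUFun]
  set θ' : ℝ := θ₀ + arg u with hθ'
  have hpol : polarAngle k - 2 * π * j = θ' := by rw [hj, hrel, hθ']; ring
  have hrepr : k = ‖momToComplex k‖ • dir θ' := by
    rw [← hpol, dir_sub_two_pi_mul]; exact polar_repr k
  have huθ : fermiRadius μ θ' = fermiRadius μ (polarAngle k) := by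
    rw [← hpol]; exact fermiRadius_sub_two_pi_mul hμ₁ hμ₂ _ _
  -- (g) radial deviation `|ρ - u(θ')| ≤ (π/(4m₀)) e₀ s`
  have hdev := radial_deviation_le hμ₁ hμ₂ θ' hρpos hkπ
  rw [← hrepr] at hdev
  have huge : m₀ ≤ fermiRadius μ θ' := by
    rw [hm₀]
    calc Real.sqrt ((4 + μ) / 2) ≤ Real.sqrt (μ + 4) := Real.sqrt_le_sqrt (by linarith)
      _ ≤ fermiRadius μ θ' := sqrt_le_fermiRadius hμ₁ hμ₂ θ'
  have hmin : m₀ ≤ min ‖momToComplex k‖ (fermiRadius μ θ') := le_min hρgt.le huge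
  have hrad : |‖momToComplex k‖ - fermiRadius μ θ'| ≤ π / (4 * m₀) * (e₀ * s) := by
    have h1 : 4 / π * m₀ * |‖momToComplex k‖ - fermiRadius μ θ'| ≤ e₀ * s :=
      le_trans (by gcongr) (hdev.trans hεabs.le)
    rw [div_mul_eq_mul_div, le_div_iff₀ (by positivity)]
    calc |‖momToComplex k‖ - fermiRadius μ θ'| * (4 * m₀) = π * (4 / π * m₀ * |‖momToComplex k‖ - fermiRadius μ θ'|) := by
          field_simp
      _ ≤ π * (e₀ * s) := mul_le_mul_of_nonneg_left h1 pi_pos.le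
  -- (h) the normal coordinate `s t₁`
  have hang : |θ' - θ₀| ≤ 3 / 4 * π * s := by
    rw [hθ', show θ₀ + arg u - θ₀ = arg u by ring]; exact hargs.le
  have hA0 : 0 ≤ accelBound μ := (abs_nonneg _).trans (abs_fermiAX_le hμ₁ hμ₂ 0)
  have hμ4 : 0 < μ + 4 := by linarith
  have hnc := abs_normalCoord_le hμ₁ hμ₂ θ₀ θ' ‖momToComplex k‖
  rw [← hrepr] at hnc
  have hncS : normalCoord μ θ₀ k = s * t₁ := by
    have := normalCoord_isoChartPoint hμ₁ hμ₂ x s; simpa [hx] using this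
  have hss : s ^ 2 ≤ s := by rw [sq]; exact mul_le_of_le_one_left hs.le hs1
  have ht₁ : |t₁| ≤ isoNormalConst μ e₀ := by
    have hsq : (θ' - θ₀) ^ 2 ≤ (3 / 4 * π * s) ^ 2 := by
      rw [← sq_abs]; exact pow_le_pow_left₀ (abs_nonneg _) hang 2
    have hC : 0 ≤ 2 * accelBound μ * Real.sqrt (π ^ 2 / 8 + (4 * π ^ 3 / (μ + 4)) ^ 2) / Real.sqrt (μ + 4) := by positivity
    have h1 : |s * t₁| ≤ isoNormalConst μ e₀ * s := by
      rw [← hncS]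
      calc _ ≤ _ := hnc
        _ ≤ π / (4 * m₀) * (e₀ * s) +
            2 * accelBound μ * Real.sqrt (π ^ 2 / 8 + (4 * π ^ 3 / (μ + 4)) ^ 2) / Real.sqrt (μ + 4) * (3 / 4 * π * s) ^ 2 :=
          add_le_add hrad (mul_le_mul_of_nonneg_left hsq hC)
        _ ≤ π / (4 * m₀) * (e₀ * s) +
            2 * accelBound μ * Real.sqrt (π ^ 2 / 8 + (4 * π ^ 3 / (μ + 4)) ^ 2) / Real.sqrt (μ + 4) * ((3 / 4 * π) ^ 2 * s) := by
          have : (3 / 4 * π * s) ^ 2 ≤ (3 / 4 * π) ^ 2 * s := by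
            rw [mul_pow]; exact mul_le_mul_of_nonneg_left hss (by positivity)
          exact add_le_add le_rfl (mul_le_mul_of_nonneg_left this hC)
        _ = isoNormalConst μ e₀ * s := by rw [isoNormalConst, hm₀]; ring
    rw [abs_mul, abs_of_pos hs, mul_comm] at h1
    exact le_of_mul_le_mul_right h1 hs
  -- (i) the tangential coordinate `s t₂`
  have htc := abs_tangentCoord_le hμ₁ hμ₂ θ₀ θ' ‖momToComplex k‖
  rw [← hrepr] at htc
  have htcS : tangentCoord μ θ₀ k = s * t₂ := by
    have := tangentCoord_isoChartPoint hμ₁ hμ₂ x s; simpa [hx] using this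
  have ht₂ : |t₂| ≤ isoTangentConst μ e₀ := by
    have hK : 0 ≤ 2 * Real.sqrt (π ^ 2 / 8 + (4 * π ^ 3 / (μ + 4)) ^ 2) := by positivity
    have h1 : |s * t₂| ≤ isoTangentConst μ e₀ * s := by
      rw [← htcS]
      calc _ ≤ _ := htc
        _ ≤ π / (4 * m₀) * (e₀ * s) + 2 * Real.sqrt (π ^ 2 / 8 + (4 * π ^ 3 / (μ + 4)) ^ 2) * (3 / 4 * π * s) :=
          add_le_add hrad (mul_le_mul_of_nonneg_left hang hK)
        _ = isoTangentConst μ e₀ * s := by rw [isoTangentConst, hm₀]; ring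
    rw [abs_mul, abs_of_pos hs, mul_comm] at h1
    exact le_of_mul_le_mul_right h1 hs
  exact ⟨ht₀, ht₁, ht₂⟩

/-- **The box at every `s ∈ [0, 1]`** (at `s = 0` by continuity: a point with `Φ̂(·; 0) ≠ 0` has
`Φ̂(·; s) ≠ 0` for small `s > 0`). [cite: BenfattoGiulianiMastropietro2003, §7.1 Lemma 7.3] -/
theorem abs_le_of_isoMasterSymbol_ne_zero_of_mem_Icc {e₀ : ℝ} (he : 0 < e₀) (he' : e₀ ≤ (4 + μ) / 2)
    {θ₀ t₀ t₁ t₂ s : ℝ} (hs : s ∈ Icc (0 : ℝ) 1) (h : isoMasterSymbol μ e₀ (θ₀, t₁, t₂) t₀ s ≠ 0) :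
    |t₀| ≤ e₀ ∧ |t₁| ≤ isoNormalConst μ e₀ ∧ |t₂| ≤ isoTangentConst μ e₀ := by
  rcases hs.1.eq_or_lt with h0 | hpos
  · -- `s = 0`: continuity in `s`
    subst h0
    set t : MomSpace := WithLp.toLp 2 ![t₀, t₁, t₂] with ht
    have hcont : Continuous fun s : ℝ => isoMasterLift μ e₀ ((θ₀, s), t) :=
      (contDiff_isoMasterLift hμ₁ hμ₂ he (μ := μ)).continuous.comp (by fun_prop)
    have hval : ∀ s, isoMasterLift μ e₀ ((θ₀, s), t) = isoMasterSymbol μ e₀ (θ₀, t₁, t₂) t₀ s := fun s => by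
      simp [isoMasterLift, ht]
    have hne : ∀ᶠ s in 𝓝 (0 : ℝ), isoMasterLift μ e₀ ((θ₀, s), t) ≠ 0 := by
      refine (hcont.continuousAt (x := 0)).eventually_ne ?_
      rwa [hval]
    have hne' : ∀ᶠ s in 𝓝[>] (0 : ℝ), isoMasterLift μ e₀ ((θ₀, s), t) ≠ 0 ∧ s ∈ Ioo (0 : ℝ) 1 :=
      (hne.filter_mono nhdsWithin_le_nhds).and (Ioo_mem_nhdsGT one_pos)
    obtain ⟨s, hs, hsI⟩ := hne'.exists
    rw [hval] at hs
    exact abs_le_of_isoMasterSymbol_ne_zero hμ₁ hμ₂ he he' hsI.1 hsI.2.le hs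
  · exact abs_le_of_isoMasterSymbol_ne_zero hμ₁ hμ₂ he he' hpos hs.2 h


/-! ### The shear antisymmetry at `r = 0` -/

/-- The shear coefficient `c = 2 isoAngCoefN/isoAngCoefT`. [folklore] -/
def isoZeroShift (μ θ : ℝ) : ℝ := 2 * isoAngCoefN μ θ / isoAngCoefT μ θ

/-- **The shear antisymmetry of the isotropic master symbol at scale zero**:
`Φ̄(θ₀, (-t₀, -t₁, t₂ + c t₁); 0) = -Φ̄(θ₀, (t₀, t₁, t₂); 0)` (a reflection along the ray: it flips
`Ē₀` and `k₀`, fixes `Ā₀`). [cite: BenfattoGiulianiMastropietro2006, §2.5 Lemma 2.2b] -/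
theorem isoMasterSymbol_zero_shear (e₀ θ t₀ t₁ t₂ : ℝ) :
    isoMasterSymbol μ e₀ (θ, -t₁, t₂ + isoZeroShift μ θ * t₁) (-t₀) 0 = -isoMasterSymbol μ e₀ (θ, t₁, t₂) t₀ 0 := by
  have hb := (isoAngCoefT_pos hμ₁ hμ₂ θ (μ := μ)).ne'
  have hE : isoRescaledDispersion μ ((θ, -t₁, t₂ + isoZeroShift μ θ * t₁), 0) = -isoRescaledDispersion μ ((θ, t₁, t₂), 0) := by
    rw [isoRescaledDispersion_zero hμ₁ hμ₂, isoRescaledDispersion_zero hμ₁ hμ₂]; ring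
  have hA : isoRescaledAngle μ ((θ, -t₁, t₂ + isoZeroShift μ θ * t₁), 0) = isoRescaledAngle μ ((θ, t₁, t₂), 0) := by
    rw [isoRescaledAngle_zero hμ₁ hμ₂, isoRescaledAngle_zero hμ₁ hμ₂, isoZeroShift]
    field_simp
    ring
  have hu : isoUFun μ (θ, -t₁, t₂ + isoZeroShift μ θ * t₁) 0 = isoUFun μ (θ, t₁, t₂) 0 := by
    rw [isoUFun_zero, isoUFun_zero]
  have hk : isoChartPoint μ (θ, -t₁, t₂ + isoZeroShift μ θ * t₁) 0 = isoChartPoint μ (θ, t₁, t₂) 0 := by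
    rw [isoChartPoint_zero, isoChartPoint_zero]
  have hD : isoRescaledDenom μ (θ, -t₁, t₂ + isoZeroShift μ θ * t₁) (-t₀) 0 = -isoRescaledDenom μ (θ, t₁, t₂) t₀ 0 := by
    rw [isoRescaledDenom, isoRescaledDenom, hE]; push_cast; ring
  rw [isoMasterSymbol, isoMasterSymbol, hE, hA, hu, hk, hD, map_neg, Complex.normSq_neg, neg_sq, neg_sq]
  ring

end Zero

end Literature.MathematicalPhysics.QuantumLattice

end
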